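import Literature.Analysis.FluidPDE.SawtoothCascade
import Literature.Analysis.FluidPDE.AnomalousDissipation
import Literature.Analysis.FluidPDE.TwoHalfNavierStokes
import Literature.Analysis.FluidPDE.DEIJCriterion
import HarnessLib
import HarnessLib.Audit
import Summits.AnomalousDissipation.AnomalousDissipation.Statement
import Summits.AnomalousDissipation.AnomalousDissipation.Theses.SawtoothPulseCascade
import Summits.AnomalousDissipation.AnomalousDissipation.Theorems.SawtoothPulseCascadeK1BoundedStrainCascadeStubFieldRegular
import Summits.AnomalousDissipation.AnomalousDissipation.Theorems.SawtoothPulseCascadeK1BoundedStrainCascadeStubCriterionTransfer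

/-! # SawtoothPulseCascade — registered BC3 birth line for crux `K1BoundedStrainCascade` (route file imported; defs from the landed
`Literature.Analysis.FluidPDE.SawtoothCascade`, p410620 + AMENDMENT 1 p410857 at 2a3fb11658ee). -/


-- `Summit.<Summit>.<Problem>`: single-conjunct summit, the duplicate namespace segment is deliberate.
set_option linter.dupNamespace false

/-! RESHAPE r1 (leafhand-ad-sawtoothpulsecasca-2 g0, 2026-08-30; NO re-planning — same three stubs, same
composition, same line): the local abbreviations `boxP`, `FieldRegular`, `BalancedInviscid` are UNFOLDED into the
stub signatures (tree vocabulary only: `CascadeFieldSmooth`, `CascadeParams.field`, `Torus.stLift`,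
`Torus.IsSmoothSpaceTimeOn`, `Torus.scalarGradNormSq`, `K1FixedFraction`), so that stub proofs under `Theorems/`
can state the registered signatures literally without a definitions file.  The hypotheses of STUB 3 are, verbatim,
the drift and inviscid-solution hypotheses of the tree's criterion
`Literature.Analysis.FluidPDE.Torus.DEIJ.le_eScalarDissipation_of_balanced_growth` (`DEIJCriterion`). -/

/-! ## BC3 birth skeleton for crux K1 `K1BoundedStrainCascade` (≥ 2 named stubs, sorries ONLY inside `stub_*`,
`K1BoundedStrainCascade_of` a real proof).  Line: DEIJ/Elgindi–Liss INVISCID BALANCED-GROWTH CRITERION, in the tree as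
`Literature.Analysis.FluidPDE.Torus.DEIJ.le_eScalarDissipation_of_balanced_growth` (weak viscous solutions, all κ > 0):
(1) the explicit field is smooth on [0,1) and bounded (anti-vacuity + the criterion's `L^∞` drift hypothesis);
(2) the inviscid cascade solution from the datum `sin 2πx₁` conserves `L²`, accumulates unbounded enstrophy before t = 1
    and grows in a BALANCED way `‖Δg‖ ≤ C‖∇g‖²` (spectral localisation at the top scale — the mixing content of K1);
(3) transfer: classical solutions on `Ico 0 1` are weak solutions on `[0,1)`, `‖datum‖² = 1/2`, and the criterion gives the
    fixed fraction `χ = 1/(16 C²)` uniformly in `κ`. -/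
namespace Summit.AnomalousDissipation.AnomalousDissipation.Cruxes.K1BoundedStrainCascade.Birth

open scoped InnerProductSpace ENNReal NNReal
open MeasureTheory Set Filter
open Literature.Analysis Literature.Analysis.FunctionSpaces Literature.Analysis.FluidPDE
open Literature.Analysis.FluidPDE.SawtoothCascade
open Summit.AnomalousDissipation.AnomalousDissipation.Theses.SawtoothPulseCascade

/-- STUB 1 (M) — LANDED p793873 (`Theorems/SawtoothPulseCascadeK1BoundedStrainCascadeStubFieldRegular.lean`), cited: the explicit field at the box point `(γ, 1/4, 2, 1, ρN)` is jointly smooth on `[0,1) × 𝕋²` (tree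
theorem `cascadeFieldSmooth`) and essentially bounded on `(0,1) × 𝕋²` (on each half-slot it is ONE shear,
`|rate_j U_j| ≤ |γ| sup bump · π⁴(j+1)⁴/(45 · 4 N_j)`, bounded in `j`). -/
theorem stub_fieldRegular :
    ∀ γ ∈ Icc (4 : ℝ) 8, ∀ ρN ∈ Finset.Icc 2 7,
      CascadeFieldSmooth ⟨γ, 1 / 4, 2, 1, ρN⟩ ∧
        MemLp (FunctionSpaces.Torus.stLift (CascadeParams.field ⟨γ, 1 / 4, 2, 1, ρN⟩)) ∞
          (volume.restrict (Ioo (0 : ℝ) 1 ×ˢ univ)) :=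
  Summit.AnomalousDissipation.AnomalousDissipation.Theorems.SawtoothPulseCascade.K1BoundedStrainCascadeBirth.stub_fieldRegular

/-- STUB 2 (L, the mixing content; why it might fail: spectral DElocalisation — if the fraction of `L²` mass at the
most-stretched scale tends to 0 (corner strips, imperfect alignment), `‖Δg‖/‖∇g‖²` is unbounded and the line dies,
not the crux): the inviscid balanced-growth package of the DEIJ / Elgindi–Liss criterion for the cascade drift and
the datum `sin 2πx₁` at every box point. -/
theorem stub_balancedInviscid :
    ∀ γ ∈ Icc (4 : ℝ) 8, ∀ ρN ∈ Finset.Icc 2 7,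
      ∃ C : ℝ, 0 < C ∧ ∃ g : ℝ → UnitAddTorus (Fin 2) → ℝ, g 0 = datum ∧
        (∀ T₁ < (1 : ℝ), ∃ G : ℝ → UnitAddTorus (Fin 2) → ℝ, FunctionSpaces.Torus.IsSmoothSpaceTimeOn univ G ∧
            (∀ t ≤ T₁, G t = g t) ∧
            ∀ t ∈ Icc 0 T₁, ∀ x, FunctionSpaces.Torus.timeDerivWithin univ G t x +
              ⟪CascadeParams.field ⟨γ, 1 / 4, 2, 1, ρN⟩ t x, FunctionSpaces.Torus.gradient (G t) x⟫_ℝ = 0) ∧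
        (∀ t ∈ Ico (0 : ℝ) 1, ∫ x, g t x ^ 2 ≤ ∫ x, g 0 x ^ 2) ∧
        (∀ A : ℝ, ∃ t ∈ Ico (0 : ℝ) 1, A ≤ ∫ s in (0 : ℝ)..t, FluidPDE.Torus.scalarGradNormSq (g s)) ∧
        (∀ t ∈ Ico (0 : ℝ) 1,
          ∫ x, FunctionSpaces.Torus.laplacian (g t) x ^ 2 ≤ (C * FluidPDE.Torus.scalarGradNormSq (g t)) ^ 2) := by
  sorry

/-- STUB 3 (M) — LANDED p794059 (`Theorems/SawtoothPulseCascadeK1BoundedStrainCascadeStubCriterionTransfer.lean`), cited: transfer through the tree's criterion `Torus.DEIJ.le_eScalarDissipation_of_balanced_growth`: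
classical solutions on `Ico 0 1` with an essentially bounded drift are weak solutions on `[0,1)`, `‖θ₀ − g 0‖ = 0`,
`scalarL2Sq datum > 0`, `χ = 1/(32 C² · scalarL2Sq datum)`. -/
theorem stub_criterionTransfer :
    ∀ P : CascadeParams,
      CascadeFieldSmooth P ∧
          MemLp (FunctionSpaces.Torus.stLift P.field) ∞ (volume.restrict (Ioo (0 : ℝ) 1 ×ˢ univ)) →
      (∃ C : ℝ, 0 < C ∧ ∃ g : ℝ → UnitAddTorus (Fin 2) → ℝ, g 0 = datum ∧
        (∀ T₁ < (1 : ℝ), ∃ G : ℝ → UnitAddTorus (Fin 2) → ℝ, FunctionSpaces.Torus.IsSmoothSpaceTimeOn univ G ∧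
            (∀ t ≤ T₁, G t = g t) ∧
            ∀ t ∈ Icc 0 T₁, ∀ x, FunctionSpaces.Torus.timeDerivWithin univ G t x +
              ⟪P.field t x, FunctionSpaces.Torus.gradient (G t) x⟫_ℝ = 0) ∧
        (∀ t ∈ Ico (0 : ℝ) 1, ∫ x, g t x ^ 2 ≤ ∫ x, g 0 x ^ 2) ∧
        (∀ A : ℝ, ∃ t ∈ Ico (0 : ℝ) 1, A ≤ ∫ s in (0 : ℝ)..t, FluidPDE.Torus.scalarGradNormSq (g s)) ∧
        (∀ t ∈ Ico (0 : ℝ) 1,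
          ∫ x, FunctionSpaces.Torus.laplacian (g t) x ^ 2 ≤ (C * FluidPDE.Torus.scalarGradNormSq (g t)) ^ 2)) →
      K1FixedFraction P :=
  Summit.AnomalousDissipation.AnomalousDissipation.Theorems.SawtoothPulseCascade.K1BoundedStrainCascadeBirth.stub_criterionTransfer

/-- Composition (kernel-checked, no sorry): the three stubs give the crux BY NAME. -/
theorem K1BoundedStrainCascade_of : K1BoundedStrainCascade := by
  intro γ hγ ρN hρ
  exact ⟨(stub_fieldRegular γ hγ ρN hρ).1,
    stub_criterionTransfer _ (stub_fieldRegular γ hγ ρN hρ) (stub_balancedInviscid γ hγ ρN hρ)⟩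

end Summit.AnomalousDissipation.AnomalousDissipation.Cruxes.K1BoundedStrainCascade.Birth
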